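import Literature.Probability.RandomPlanarGeometry.HexSAWSurfaceWallRenewalSlackTwoClassification
import Literature.Probability.RandomPlanarGeometry.HexSAWSurfaceWallRenewalIteratedGap
import HarnessLib

/-!
# Slack four, four down steps: the order `D D D U U U D U` (deep hairpin, then a bump) does not occur

For the self-avoiding walk on the honeycomb lattice (brick-wall frame) in the half-plane `Y ≤ 0`, consider an IRREDUCIBLE
POSITIVE WALL BRIDGE `ω ∈ ipwb m` at SLACK FOUR (`m = 6k + 4`, `k = visits m ω ≥ 2`) with FOUR down steps, in the vertical
profile of `profile_of_card_stepsD_eq_four` (`…FourDownProfile`): down times `p₁ < p₂ < p₃ < p₄`, up times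
`r₁ < r₂ < r₃ < r₄`, the initial wall run `(i, 0)`, `i ≤ p₁`, the first dive at the odd time `p₁`, all other steps horizontal.

* `ddduuudu_slack_four_false` — the vertical order `p₁ < p₂ < p₃ < r₁ < r₂ < r₃ < p₄ < r₄` (word `D D D U U U D U`: an
  excursion to depth three, a wall run, then a BUMP `D U`) is impossible.

PROOF (near-renewal count).  §1 is the run decomposition of the order (seven monotone body runs on the rows
`−1, −2, −3, −2, −1, 0, −1`, `run_const_velocity` of `…SecondGap`; the rightward final wall run; the visit count
`p₁ + p₄ + m = r₃ + r₄ + 2k + 2` by `visits_add` / `visits_add_eq_left`; column parities by `of_mem_stepsD_coord` /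
`of_mem_stepsU_coord`; the same text as the occurring orders of `…SlackFourFourDownRuns`).  §2: the bump plateau goes RIGHT
(a left plateau is crossed by the final wall run at the dive column) and the wall run before it goes RIGHT (else the walk
returns to the wall on the plateau's column, or the bump dives onto the return site); then every interior visit time on that
wall run or on the final run that is a NEAR-RENEWAL (`NearRenewal` of `…SixStep`) is a wall-renewal time
(`isWRen_of_profile`: everything after it lies strictly to its right), and an initial-run visit time `t ≥ 4` is not a
near-renewal because the walk comes back to the column `2` (`exists_left_step_onto` at the time `2`); so the set `E` of
interior near-renewal visit times is `⊆ {2}`, `#E ≤ 1`, and `slack_four_counts` (`…IteratedGap`) forces the span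
`X = 2k + 2` (`X = 2k + 4` with four down steps needs `#E = 2`).  But `X = c₀ + (m − r₃ − 3)` where `c₀ = X_{r₃} ≥ p₁ + 2`
is the column of the return to the wall (a fresh wall site, odd like `p₁`), and with the visit count this reads
`c₀ = p₁ + p₄ + 3 − r₄ ≤ p₁ + 1` — contradiction.

STATUS: lane theorem of the a-idea-1 bridge/renewal lineage (car 94-C), third module of the ORDER EXCLUSION for four down
steps at slack four (with `…SlackFourFourDownLeadingBump`: the orders `D U …`; FINDING-HEX-WALL-SLACK-FOUR-LAW, the four-down
law `12·N = (k − 2)(2k⁴ − 7k³ + 4k² + 7k + 6)`).  OURS (routine): checked against the lane's enumeration of all irreducible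
positive wall bridges at slack four for `k ≤ 8` (no word `D D D U U U D U` among the `0, 3, 27, 129, 424, 1105, 2463` four-down
walks at `k = 2 … 8`; the order does occur at slack fourteen, `n = 26`, `k = 2` — the exclusion is a slack-four fact).  The
printed sources carry the renewal / irreducible-bridge structure (Madras–Slade §4.2, Definition 4.2.1, remark before
(4.2.21), p. 94) and the brickwork frame of the honeycomb lattice (Enting–Jensen §7.4.2, Fig. 7.10) — none states this fact.
No `set_option maxHeartbeats` line is used.
-/

namespace Literature.Probability.RandomPlanarGeometry.SAW.HexBW.Wall

open Finset Filter Function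
open Literature.Probability.LatticeModels Literature.Probability.Percolation SimpleGraph

variable {ω : ℕ → Site 2}

/-- [folklore] Two coordinates determine a site of `ℤ²`. -/
private theorem site_ext_hb {p q : Site 2} (h0 : p 0 = q 0) (h1 : p 1 = q 1) : p = q := by
  funext k
  fin_cases k
  · exact h0
  · exact h1

/-- [folklore] Slack-four visit numerics, one interior wall run `(s, q]`. -/
private theorem visits_count_hb_w1 {k m p q s r : ℕ} (hm : m = 6 * k + 4) (hv : p / 2 + (q - s) / 2 + (m - r) / 2 = k)
    (hp : p % 2 = 1) (hq : q % 2 = 1) (hs : s % 2 = 0) (hsq : s < q) (hr : r % 2 = 0) (hrm : r < m) :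
    p + q + m = s + r + 2 * k + 2 := by
  omega

/-- **Runs of the order `D D D U U U D U`.** For `m = 6k + 4`, `ω ∈ ipwb m` with `k` visits, four down steps at
`p₁ < p₂ < p₃ < p₄` and four up steps at `r₁ < r₂ < r₃ < r₄` in the order `p₃ < r₁`, `r₃ < p₄ < r₄`, in the profile of
`profile_of_card_stepsD_eq_four`: the seven monotone body runs (rows `−1, −2, −3, −2, −1, 0, −1`) with their signs, the
rightward final wall run, the visit count `p₁ + p₄ + m = r₃ + r₄ + 2k + 2`, the final-run length, the column parities, the
positivity of the interior columns and the gaps between consecutive vertical steps.  Same generator as the occurring orders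
(`…SlackFourFourDownRuns`); tool for `ddduuudu_slack_four_false`.  OURS (routine).
[cite: MadrasSlade1993, §4.2, Definition 4.2.1 (p. 90), (4.2.2); EntingJensen2009, §7.4.2, Fig. 7.10] -/
theorem ddduuudu4_runs {k m : ℕ} (hm : m = 6 * k + 4) (hω : ω ∈ ipwb m) (hv : visits m ω = k)
    {p₁ p₂ p₃ p₄ r₁ r₂ r₃ r₄ : ℕ} (hD : stepsD m ω = {p₁, p₂, p₃, p₄}) (hU : stepsU m ω = {r₁, r₂, r₃, r₄})
    (h12 : p₁ < p₂) (h23 : p₂ < p₃) (h34 : p₃ < p₄) (hr12 : r₁ < r₂) (hr23 : r₂ < r₃) (hr34 : r₃ < r₄)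
    (ht3 : p₃ < r₁) (ht6 : r₃ < p₄) (ht7 : p₄ < r₄) (hp1 : 1 ≤ p₁) (hR0 : ∀ i, i ≤ p₁ → ω i 0 = i ∧ ω i 1 = 0)
    (hP1x : ω (p₁ + 1) 0 = p₁) (hP1y : ω (p₁ + 1) 1 = -1)
    (hhor : ∀ i, i < m → i ∉ stepsD m ω → i ∉ stepsU m ω →
      ω (i + 1) 1 = ω i 1 ∧ (ω (i + 1) 0 = ω i 0 + 1 ∨ ω (i + 1) 0 = ω i 0 - 1)) :
    ∃ e₁ e₂ e₃ e₄ e₅ e₆ e₇ : ℤ, (e₁ = 1 ∨ e₁ = -1) ∧ (e₂ = 1 ∨ e₂ = -1) ∧ (e₃ = 1 ∨ e₃ = -1) ∧ (e₄ = 1 ∨ e₄ = -1) ∧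
      (e₅ = 1 ∨ e₅ = -1) ∧ (e₆ = 1 ∨ e₆ = -1) ∧ (e₇ = 1 ∨ e₇ = -1) ∧
      (∀ i, p₁ + 1 ≤ i → i ≤ p₂ → ω i 0 = p₁ + e₁ * ((i - (p₁ + 1) : ℕ) : ℤ) ∧ ω i 1 = -1) ∧
      (∀ i, p₂ + 1 ≤ i → i ≤ p₃ → ω i 0 = ω p₂ 0 + e₂ * ((i - (p₂ + 1) : ℕ) : ℤ) ∧ ω i 1 = -2) ∧
      (∀ i, p₃ + 1 ≤ i → i ≤ r₁ → ω i 0 = ω p₃ 0 + e₃ * ((i - (p₃ + 1) : ℕ) : ℤ) ∧ ω i 1 = -3) ∧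
      (∀ i, r₁ + 1 ≤ i → i ≤ r₂ → ω i 0 = ω r₁ 0 + e₄ * ((i - (r₁ + 1) : ℕ) : ℤ) ∧ ω i 1 = -2) ∧
      (∀ i, r₂ + 1 ≤ i → i ≤ r₃ → ω i 0 = ω r₂ 0 + e₅ * ((i - (r₂ + 1) : ℕ) : ℤ) ∧ ω i 1 = -1) ∧
      (∀ i, r₃ + 1 ≤ i → i ≤ p₄ → ω i 0 = ω r₃ 0 + e₆ * ((i - (r₃ + 1) : ℕ) : ℤ) ∧ ω i 1 = 0) ∧
      (∀ i, p₄ + 1 ≤ i → i ≤ r₄ → ω i 0 = ω p₄ 0 + e₇ * ((i - (p₄ + 1) : ℕ) : ℤ) ∧ ω i 1 = -1) ∧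
      (∀ j, r₄ + 1 ≤ j → j ≤ m → ω j 0 = ω r₄ 0 + ((j - (r₄ + 1) : ℕ) : ℤ) ∧ ω j 1 = 0) ∧
      p₁ + p₄ + m = r₃ + r₄ + 2 * k + 2 ∧ ω m 0 + r₄ + 1 = ω r₄ 0 + m ∧
      ω p₂ 0 % 2 = 0 ∧ ω p₃ 0 % 2 = 1 ∧ ω r₁ 0 % 2 = 1 ∧ ω r₂ 0 % 2 = 0 ∧ ω r₃ 0 % 2 = 1 ∧ ω p₄ 0 % 2 = 1 ∧
      ω r₄ 0 % 2 = 1 ∧ 0 < ω p₂ 0 ∧ 0 < ω p₃ 0 ∧ 0 < ω r₁ 0 ∧ 0 < ω r₂ 0 ∧ 0 < ω r₃ 0 ∧ 0 < ω p₄ 0 ∧ p₁ + 2 ≤ p₂ ∧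
      p₂ + 2 ≤ p₃ ∧ p₃ + 2 ≤ r₁ ∧ r₃ + 2 ≤ p₄ ∧ p₄ + 2 ≤ r₄ ∧ r₄ < m := by
  classical
  obtain ⟨hpw, hn1, hirr⟩ := mem_ipwb.1 hω
  obtain ⟨hw, hb⟩ := mem_pwb.1 hpw
  obtain ⟨ha, -⟩ := mem_wbr.1 hw
  obtain ⟨hh, -, -⟩ := mem_archs.1 ha
  obtain ⟨hs, hhp⟩ := mem_hpw.1 hh
  obtain ⟨h0, -, hbw, hinj⟩ := mem_saws_iff.1 hs
  have hX0 : ω 0 0 = 0 := by rw [h0]; rfl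
  have hb' : ∀ i, 1 ≤ i → i ≤ m → 0 < ω i 0 ∧ ω i 0 ≤ ω m 0 := fun i h1 h2 => by
    have := hb i h1 h2; rwa [hX0] at this
  have hmem : ∀ i, i ≤ m → i ∈ {i | i ≤ m} := fun i hi => hi
  have hmD : ∀ i, i ∈ stepsD m ω ↔ i = p₁ ∨ i = p₂ ∨ i = p₃ ∨ i = p₄ := fun i => by
    rw [hD]; simp only [Finset.mem_insert, Finset.mem_singleton]
  have hmU : ∀ i, i ∈ stepsU m ω ↔ i = r₁ ∨ i = r₂ ∨ i = r₃ ∨ i = r₄ := fun i => by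
    rw [hU]; simp only [Finset.mem_insert, Finset.mem_singleton]
  obtain ⟨-, -, -, hpar_p₁⟩ := of_mem_stepsD_coord hbw (i := p₁) ((hmD _).2 (by simp))
  have hx_p₁ : ω (p₁ + 1) 0 = ω p₁ 0 := by rw [hP1x, (hR0 p₁ le_rfl).1]
  have hy_p₁ : ω p₁ 1 = 0 := (hR0 p₁ le_rfl).2
  obtain ⟨hn_p₂, hx_p₂, hys_p₂, hpar_p₂⟩ := of_mem_stepsD_coord hbw (i := p₂) ((hmD _).2 (by simp))
  obtain ⟨hn_p₃, hx_p₃, hys_p₃, hpar_p₃⟩ := of_mem_stepsD_coord hbw (i := p₃) ((hmD _).2 (by simp))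
  obtain ⟨hn_r₁, hx_r₁, hys_r₁, hpar_r₁⟩ := of_mem_stepsU_coord hbw (i := r₁) ((hmU _).2 (by simp))
  obtain ⟨hn_r₂, hx_r₂, hys_r₂, hpar_r₂⟩ := of_mem_stepsU_coord hbw (i := r₂) ((hmU _).2 (by simp))
  obtain ⟨hn_r₃, hx_r₃, hys_r₃, hpar_r₃⟩ := of_mem_stepsU_coord hbw (i := r₃) ((hmU _).2 (by simp))
  obtain ⟨hn_p₄, hx_p₄, hys_p₄, hpar_p₄⟩ := of_mem_stepsD_coord hbw (i := p₄) ((hmD _).2 (by simp))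
  obtain ⟨hn_r₄, hx_r₄, hys_r₄, hpar_r₄⟩ := of_mem_stepsU_coord hbw (i := r₄) ((hmU _).2 (by simp))
  have hhor' : ∀ i, i < m → i ≠ p₁ → i ≠ p₂ → i ≠ p₃ → i ≠ p₄ → i ≠ r₁ → i ≠ r₂ → i ≠ r₃ → i ≠ r₄ →
      ω (i + 1) 1 = ω i 1 ∧ (ω (i + 1) 0 = ω i 0 + 1 ∨ ω (i + 1) 0 = ω i 0 - 1) :=
    fun i hi n1 n2 n3 n4 n5 n6 n7 n8 => hhor i hi (by rw [hmD]; omega) (by rw [hmU]; omega)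
  -- run 1 on row `−1`
  obtain ⟨e1, he1, hrun1⟩ := run_const_velocity hinj (a := p₁ + 1) (b := p₂) (by omega) (by omega)
    (fun i hi1 hi2 => hhor' i (by omega) (by omega) (by omega) (by omega) (by omega) (by omega) (by omega) (by omega) (by omega))
  have hy_p₂ : ω p₂ 1 = -1 := by rw [(hrun1 p₂ (by omega) le_rfl).2, hP1y]
  have hy1_p₂ : ω (p₂ + 1) 1 = -2 := by rw [hys_p₂, hy_p₂]; rfl
  have hparc_p₂ : ω p₂ 0 % 2 = 0 := by rw [hx_p₂, hy1_p₂] at hpar_p₂; omega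
  have hpos_p₂ := (hb' p₂ (by omega) (by omega)).1
  -- run 2 on row `−2`
  obtain ⟨e2, he2, hrun2⟩ := run_const_velocity hinj (a := p₂ + 1) (b := p₃) (by omega) (by omega)
    (fun i hi1 hi2 => hhor' i (by omega) (by omega) (by omega) (by omega) (by omega) (by omega) (by omega) (by omega) (by omega))
  have hy_p₃ : ω p₃ 1 = -2 := by rw [(hrun2 p₃ (by omega) le_rfl).2, hy1_p₂]
  have hy1_p₃ : ω (p₃ + 1) 1 = -3 := by rw [hys_p₃, hy_p₃]; rfl
  have hparc_p₃ : ω p₃ 0 % 2 = 1 := by rw [hx_p₃, hy1_p₃] at hpar_p₃; omega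
  have hpos_p₃ := (hb' p₃ (by omega) (by omega)).1
  -- run 3 on row `−3`
  obtain ⟨e3, he3, hrun3⟩ := run_const_velocity hinj (a := p₃ + 1) (b := r₁) (by omega) (by omega)
    (fun i hi1 hi2 => hhor' i (by omega) (by omega) (by omega) (by omega) (by omega) (by omega) (by omega) (by omega) (by omega))
  have hy_r₁ : ω r₁ 1 = -3 := by rw [(hrun3 r₁ (by omega) le_rfl).2, hy1_p₃]
  have hy1_r₁ : ω (r₁ + 1) 1 = -2 := by rw [hys_r₁, hy_r₁]; rfl
  have hparc_r₁ : ω r₁ 0 % 2 = 1 := by rw [hy_r₁] at hpar_r₁; omega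
  have hpos_r₁ := (hb' r₁ (by omega) (by omega)).1
  -- run 4 on row `−2`
  obtain ⟨e4, he4, hrun4⟩ := run_const_velocity hinj (a := r₁ + 1) (b := r₂) (by omega) (by omega)
    (fun i hi1 hi2 => hhor' i (by omega) (by omega) (by omega) (by omega) (by omega) (by omega) (by omega) (by omega) (by omega))
  have hy_r₂ : ω r₂ 1 = -2 := by rw [(hrun4 r₂ (by omega) le_rfl).2, hy1_r₁]
  have hy1_r₂ : ω (r₂ + 1) 1 = -1 := by rw [hys_r₂, hy_r₂]; rfl
  have hparc_r₂ : ω r₂ 0 % 2 = 0 := by rw [hy_r₂] at hpar_r₂; omega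
  have hpos_r₂ := (hb' r₂ (by omega) (by omega)).1
  -- run 5 on row `−1`
  obtain ⟨e5, he5, hrun5⟩ := run_const_velocity hinj (a := r₂ + 1) (b := r₃) (by omega) (by omega)
    (fun i hi1 hi2 => hhor' i (by omega) (by omega) (by omega) (by omega) (by omega) (by omega) (by omega) (by omega) (by omega))
  have hy_r₃ : ω r₃ 1 = -1 := by rw [(hrun5 r₃ (by omega) le_rfl).2, hy1_r₂]
  have hy1_r₃ : ω (r₃ + 1) 1 = 0 := by rw [hys_r₃, hy_r₃]; rfl
  have hparc_r₃ : ω r₃ 0 % 2 = 1 := by rw [hy_r₃] at hpar_r₃; omega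
  have hpos_r₃ := (hb' r₃ (by omega) (by omega)).1
  -- run 6 on row `0`
  obtain ⟨e6, he6, hrun6⟩ := run_const_velocity hinj (a := r₃ + 1) (b := p₄) (by omega) (by omega)
    (fun i hi1 hi2 => hhor' i (by omega) (by omega) (by omega) (by omega) (by omega) (by omega) (by omega) (by omega) (by omega))
  have hy_p₄ : ω p₄ 1 = 0 := by rw [(hrun6 p₄ (by omega) le_rfl).2, hy1_r₃]
  have hy1_p₄ : ω (p₄ + 1) 1 = -1 := by rw [hys_p₄, hy_p₄]; rfl
  have hparc_p₄ : ω p₄ 0 % 2 = 1 := by rw [hx_p₄, hy1_p₄] at hpar_p₄; omega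
  have hpos_p₄ := (hb' p₄ (by omega) (by omega)).1
  -- run 7 on row `−1`
  obtain ⟨e7, he7, hrun7⟩ := run_const_velocity hinj (a := p₄ + 1) (b := r₄) (by omega) (by omega)
    (fun i hi1 hi2 => hhor' i (by omega) (by omega) (by omega) (by omega) (by omega) (by omega) (by omega) (by omega) (by omega))
  have hy_r₄ : ω r₄ 1 = -1 := by rw [(hrun7 r₄ (by omega) le_rfl).2, hy1_p₄]
  have hy1_r₄ : ω (r₄ + 1) 1 = 0 := by rw [hys_r₄, hy_r₄]; rfl
  have hparc_r₄ : ω r₄ 0 % 2 = 1 := by rw [hy_r₄] at hpar_r₄; omega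
  have htev_r₃ : r₃ % 2 = 0 := by
    have := parity_apply hs (show r₃ ≤ m by omega); rw [hy_r₃] at this; omega
  have htodd_p₄ : p₄ % 2 = 1 := by
    have := parity_apply hs (show p₄ ≤ m by omega); rw [hy_p₄] at this; omega
  have hsev : r₄ % 2 = 0 := by have := parity_apply hs (show r₄ ≤ m by omega); rw [hy_r₄] at this; omega
  -- the final run on the wall goes right
  obtain ⟨e8, he8, hrun8⟩ := run_const_velocity hinj (a := r₄ + 1) (b := m) (by omega) le_rfl
    (fun i hi1 hi2 => hhor' i (by omega) (by omega) (by omega) (by omega) (by omega) (by omega) (by omega) (by omega)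
      (by omega))
  obtain rfl : e8 = 1 := by
    rcases he8 with h | rfl
    · exact h
    exfalso
    have hN := (hrun8 m (by omega) le_rfl).1
    have hbn := (hb' (r₄ + 1) (by omega) (by omega)).2
    rw [hx_r₄] at hN hbn
    omega
  have hR8 : ∀ j, r₄ + 1 ≤ j → j ≤ m → ω j 0 = ω r₄ 0 + ((j - (r₄ + 1) : ℕ) : ℤ) ∧ ω j 1 = 0 := fun j hj1 hj2 => by
    obtain ⟨hx, hy⟩ := hrun8 j hj1 hj2
    rw [hx_r₄] at hx; rw [hy1_r₄] at hy
    exact ⟨by rw [hx]; ring, hy⟩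
  -- the visit count
  have hvf : visits m ω = p₁ / 2 + (p₄ - r₃) / 2 + (m - r₄) / 2 := by
    have hv1 : visits p₁ ω = p₁ / 2 := visits_eq_div_two_of_wall (fun i _ hi2 => (hR0 i hi2).2)
    have hvA1 : visits r₃ ω = visits p₁ ω := by
      have := visits_add_eq_left (k := p₁) (b := r₃ - p₁) (ζ := ω) (fun j hj1 hj2 => ?_)
      · rwa [show p₁ + (r₃ - p₁) = r₃ by omega] at this
      rintro ⟨-, hy⟩
      rcases Nat.lt_or_ge (p₁ + j) (p₂ + 1) with hj1' | hj1
      · have := (hrun1 (p₁ + j) (by omega) (by omega)).2; rw [hP1y] at this; omega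
      rcases Nat.lt_or_ge (p₁ + j) (p₃ + 1) with hj2' | hj2
      · have := (hrun2 (p₁ + j) hj1 (by omega)).2; rw [hy1_p₂] at this; omega
      rcases Nat.lt_or_ge (p₁ + j) (r₁ + 1) with hj3' | hj3
      · have := (hrun3 (p₁ + j) hj2 (by omega)).2; rw [hy1_p₃] at this; omega
      rcases Nat.lt_or_ge (p₁ + j) (r₂ + 1) with hj4' | hj4
      · have := (hrun4 (p₁ + j) hj3 (by omega)).2; rw [hy1_r₁] at this; omega
      · have := (hrun5 (p₁ + j) hj4 (by omega)).2; rw [hy1_r₂] at this; omega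
    have hvB1 : visits p₄ ω = visits r₃ ω + visits (p₄ - r₃) (fun _ => (0 : Site 2)) := by
      have := visits_add (a := r₃) (b := p₄ - r₃) (ζ := ω) (ξ := fun _ => (0 : Site 2)) htev_r₃ (fun j hj1 hj2 => ?_)
      · rwa [show r₃ + (p₄ - r₃) = p₄ by omega] at this
      rw [(hrun6 (r₃ + j) (by omega) (by omega)).2, hy1_r₃]; rfl
    have hvC1 : visits (p₄ - r₃) (fun _ => (0 : Site 2)) = (p₄ - r₃) / 2 :=
      visits_eq_div_two_of_wall (fun i _ _ => rfl)
    have hvA2 : visits r₄ ω = visits p₄ ω := by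
      have := visits_add_eq_left (k := p₄) (b := r₄ - p₄) (ζ := ω) (fun j hj1 hj2 => ?_)
      · rwa [show p₄ + (r₄ - p₄) = r₄ by omega] at this
      rintro ⟨-, hy⟩
      · have := (hrun7 (p₄ + j) (by omega) (by omega)).2; rw [hy1_p₄] at this; omega
    have hv3 : visits m ω = visits r₄ ω + visits (m - r₄) (fun _ => (0 : Site 2)) := by
      have := visits_add (a := r₄) (b := m - r₄) (ζ := ω) (ξ := fun _ => (0 : Site 2)) hsev (fun j hj1 hj2 => ?_)
      · rwa [show r₄ + (m - r₄) = m by omega] at this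
      rw [(hR8 (r₄ + j) (by omega) (by omega)).2]; rfl
    have hv4 : visits (m - r₄) (fun _ => (0 : Site 2)) = (m - r₄) / 2 := visits_eq_div_two_of_wall (fun i _ _ => rfl)
    rw [hv3, hvA2, hvB1, hvA1, hv1, hvC1, hv4]
  rw [hvf] at hv
  have hpodd : p₁ % 2 = 1 := by rw [hP1x, hP1y] at hpar_p₁; omega
  have hs_eq : p₁ + p₄ + m = r₃ + r₄ + 2 * k + 2 :=
    visits_count_hb_w1 hm hv hpodd htodd_p₄ htev_r₃ (show r₃ < p₄ by omega) hsev hn_r₄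
  have hN' : ω m 0 + r₄ + 1 = ω r₄ 0 + m := by
    rw [(hR8 m (by omega) le_rfl).1]; omega
  -- gaps between consecutive vertical steps
  have hgap1 : p₁ + 2 ≤ p₂ := by
    by_contra h
    obtain rfl : p₂ = p₁ + 1 := by omega
    rw [hx_p₂, hP1x] at hpar_p₂; rw [hy1_p₂] at hpar_p₂; omega
  have hgap2 : p₂ + 2 ≤ p₃ := by
    by_contra h
    obtain rfl : p₃ = p₂ + 1 := by omega
    rw [hx_p₃, hx_p₂] at hpar_p₃; rw [hy1_p₃] at hpar_p₃; rw [hx_p₂, hy1_p₂] at hpar_p₂; omega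
  have hgap3 : p₃ + 2 ≤ r₁ := by
    by_contra h
    obtain rfl : r₁ = p₃ + 1 := by omega
    have := hinj (hmem (p₃ + 1 + 1) (by omega)) (hmem p₃ (by omega))
      (site_ext_hb (by rw [hx_r₁, hx_p₃]) (by rw [hy1_r₁, hy_p₃]))
    omega
  have hgap6 : r₃ + 2 ≤ p₄ := by
    by_contra h
    obtain rfl : p₄ = r₃ + 1 := by omega
    have := hinj (hmem (r₃ + 1 + 1) (by omega)) (hmem r₃ (by omega))
      (site_ext_hb (by rw [hx_p₄, hx_r₃]) (by rw [hy1_p₄, hy_r₃]))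
    omega
  have hgap7 : p₄ + 2 ≤ r₄ := by
    by_contra h
    obtain rfl : r₄ = p₄ + 1 := by omega
    have := hinj (hmem (p₄ + 1 + 1) (by omega)) (hmem p₄ (by omega))
      (site_ext_hb (by rw [hx_r₄, hx_p₄]) (by rw [hy1_r₄, hy_p₄]))
    omega
  refine ⟨e1, e2, e3, e4, e5, e6, e7, he1, he2, he3, he4, he5, he6, he7,
    fun i hi1 hi2 => ⟨by rw [(hrun1 i hi1 hi2).1, hP1x], by rw [(hrun1 i hi1 hi2).2, hP1y]⟩,
    fun i hi1 hi2 => ⟨by rw [(hrun2 i hi1 hi2).1, hx_p₂], by rw [(hrun2 i hi1 hi2).2, hy1_p₂]⟩,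
    fun i hi1 hi2 => ⟨by rw [(hrun3 i hi1 hi2).1, hx_p₃], by rw [(hrun3 i hi1 hi2).2, hy1_p₃]⟩,
    fun i hi1 hi2 => ⟨by rw [(hrun4 i hi1 hi2).1, hx_r₁], by rw [(hrun4 i hi1 hi2).2, hy1_r₁]⟩,
    fun i hi1 hi2 => ⟨by rw [(hrun5 i hi1 hi2).1, hx_r₂], by rw [(hrun5 i hi1 hi2).2, hy1_r₂]⟩,
    fun i hi1 hi2 => ⟨by rw [(hrun6 i hi1 hi2).1, hx_r₃], by rw [(hrun6 i hi1 hi2).2, hy1_r₃]⟩,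
    fun i hi1 hi2 => ⟨by rw [(hrun7 i hi1 hi2).1, hx_p₄], by rw [(hrun7 i hi1 hi2).2, hy1_p₄]⟩,
    hR8, hs_eq, hN', hparc_p₂, hparc_p₃, hparc_r₁, hparc_r₂, hparc_r₃, hparc_p₄, hparc_r₄, hpos_p₂, hpos_p₃, hpos_r₁,
    hpos_r₂, hpos_r₃, hpos_p₄, hgap1, hgap2, hgap3, hgap6, hgap7, hn_r₄⟩


/-- Step 1 for `ddduuudu_slack_four_false`: the bump plateau goes RIGHT (a left plateau would be crossed by the final wall run
at the dive column `X_{p₄}`).  OURS (routine).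
[cite: MadrasSlade1993, §4.2, Definition 4.2.1 (p. 90), remark before (4.2.21) (p. 94); EntingJensen2009, §7.4.2, Fig. 7.10] -/
theorem ddduuudu_plateau {k m : ℕ} (hm : m = 6 * k + 4) (hω : ω ∈ ipwb m) (hv : visits m ω = k)
    {p₁ p₂ p₃ p₄ r₁ r₂ r₃ r₄ : ℕ} (hD : stepsD m ω = {p₁, p₂, p₃, p₄}) (hU : stepsU m ω = {r₁, r₂, r₃, r₄}) (h12 : p₁ < p₂)
    (h23 : p₂ < p₃) (h34 : p₃ < p₄) (hr12 : r₁ < r₂) (hr23 : r₂ < r₃) (hr34 : r₃ < r₄) (ht3 : p₃ < r₁) (ht6 : r₃ < p₄) (ht7 : p₄ < r₄) (hp1 : 1 ≤ p₁)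
    (hR0 : ∀ i, i ≤ p₁ → ω i 0 = i ∧ ω i 1 = 0) (hP1x : ω (p₁ + 1) 0 = p₁) (hP1y : ω (p₁ + 1) 1 = -1)
    (hhor : ∀ i, i < m → i ∉ stepsD m ω → i ∉ stepsU m ω →
      ω (i + 1) 1 = ω i 1 ∧ (ω (i + 1) 0 = ω i 0 + 1 ∨ ω (i + 1) 0 = ω i 0 - 1)) :
    ∀ i, p₄ + 1 ≤ i → i ≤ r₄ → ω i 0 = ω p₄ 0 + ((i - (p₄ + 1) : ℕ) : ℤ) ∧ ω i 1 = -1 := by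
  classical
  obtain ⟨hpw, hn1, hirr⟩ := mem_ipwb.1 hω
  obtain ⟨hw, hb⟩ := mem_pwb.1 hpw
  obtain ⟨ha, -⟩ := mem_wbr.1 hw
  obtain ⟨hh, -, -⟩ := mem_archs.1 ha
  obtain ⟨hs, hhp⟩ := mem_hpw.1 hh
  obtain ⟨h0, -, hbw, hinj⟩ := mem_saws_iff.1 hs
  have hX0 : ω 0 0 = 0 := by rw [h0]; rfl
  have hb' : ∀ i, 1 ≤ i → i ≤ m → 0 < ω i 0 ∧ ω i 0 ≤ ω m 0 := fun i h1 h2 => by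
    have := hb i h1 h2; rwa [hX0] at this
  have hmem : ∀ i, i ≤ m → i ∈ {i | i ≤ m} := fun i hi => hi
  obtain ⟨e₁, e₂, e₃, e₄, e₅, e₆, e₇, -, -, -, -, -, he6, he7, hrun1, hrun2, hrun3, hrun4, hrun5, hrun6, hrun7, hR8,
    hs_eq, hN', -, -, -, -, hparc_r₃, hparc_p₄, -, -, -, -, -, hpos_r₃, -, -, -, -, hgap6, hgap7, hn_r₄⟩ :=
    ddduuudu4_runs hm hω hv hD hU h12 h23 h34 hr12 hr23 hr34 ht3 ht6 ht7 hp1 hR0 hP1x hP1y hhor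
  obtain ⟨-, hx_p₄, -, -⟩ := of_mem_stepsD_coord hbw (i := p₄) (by rw [hD]; simp)
  have hy_p₄ := (hrun6 p₄ (by omega) le_rfl).2
  have hy_r₃ := (hrun5 r₃ (by omega) le_rfl).2
  have hR4' := hR8 (r₄ + 1) le_rfl (by omega)
  simp only [Nat.sub_self, Nat.cast_zero, add_zero] at hR4'
  have hR7 := (hrun7 r₄ (by omega) le_rfl).1
  obtain rfl : e₇ = 1 := by
    rcases he7 with h | rfl
    · exact h
    exfalso
    have hle := (hb' p₄ (by omega) (by omega)).2
    obtain ⟨hjx, hjy⟩ := hR8 (2 * r₄ - p₄) (by omega) (by omega)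
    have hc := hinj (hmem (2 * r₄ - p₄) (by omega)) (hmem p₄ (by omega)) (site_ext_hb (by omega) (by rw [hjy, hy_p₄]))
    omega
  simpa only [one_mul] using hrun7

/-- Step 2 for `ddduuudu_slack_four_false`: the wall run before the bump goes RIGHT (else the walk is back on the wall at a
site of that wall run, or the plateau passes under the return site `ω r₃`).  OURS (routine).
[cite: MadrasSlade1993, §4.2, Definition 4.2.1 (p. 90), remark before (4.2.21) (p. 94); EntingJensen2009, §7.4.2, Fig. 7.10] -/
theorem ddduuudu_wallRun {k m : ℕ} (hm : m = 6 * k + 4) (hω : ω ∈ ipwb m) (hv : visits m ω = k)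
    {p₁ p₂ p₃ p₄ r₁ r₂ r₃ r₄ : ℕ} (hD : stepsD m ω = {p₁, p₂, p₃, p₄}) (hU : stepsU m ω = {r₁, r₂, r₃, r₄}) (h12 : p₁ < p₂)
    (h23 : p₂ < p₃) (h34 : p₃ < p₄) (hr12 : r₁ < r₂) (hr23 : r₂ < r₃) (hr34 : r₃ < r₄) (ht3 : p₃ < r₁) (ht6 : r₃ < p₄) (ht7 : p₄ < r₄) (hp1 : 1 ≤ p₁)
    (hR0 : ∀ i, i ≤ p₁ → ω i 0 = i ∧ ω i 1 = 0) (hP1x : ω (p₁ + 1) 0 = p₁) (hP1y : ω (p₁ + 1) 1 = -1)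
    (hhor : ∀ i, i < m → i ∉ stepsD m ω → i ∉ stepsU m ω →
      ω (i + 1) 1 = ω i 1 ∧ (ω (i + 1) 0 = ω i 0 + 1 ∨ ω (i + 1) 0 = ω i 0 - 1)) :
    ∀ i, r₃ + 1 ≤ i → i ≤ p₄ → ω i 0 = ω r₃ 0 + ((i - (r₃ + 1) : ℕ) : ℤ) ∧ ω i 1 = 0 := by
  classical
  obtain ⟨hpw, hn1, hirr⟩ := mem_ipwb.1 hω
  obtain ⟨hw, hb⟩ := mem_pwb.1 hpw
  obtain ⟨ha, -⟩ := mem_wbr.1 hw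
  obtain ⟨hh, -, -⟩ := mem_archs.1 ha
  obtain ⟨hs, hhp⟩ := mem_hpw.1 hh
  obtain ⟨h0, -, hbw, hinj⟩ := mem_saws_iff.1 hs
  have hX0 : ω 0 0 = 0 := by rw [h0]; rfl
  have hb' : ∀ i, 1 ≤ i → i ≤ m → 0 < ω i 0 ∧ ω i 0 ≤ ω m 0 := fun i h1 h2 => by
    have := hb i h1 h2; rwa [hX0] at this
  have hmem : ∀ i, i ≤ m → i ∈ {i | i ≤ m} := fun i hi => hi
  obtain ⟨e₁, e₂, e₃, e₄, e₅, e₆, e₇, -, -, -, -, -, he6, he7, hrun1, hrun2, hrun3, hrun4, hrun5, hrun6, hrun7, hR8,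
    hs_eq, hN', -, -, -, -, hparc_r₃, hparc_p₄, -, -, -, -, -, hpos_r₃, -, -, -, -, hgap6, hgap7, hn_r₄⟩ :=
    ddduuudu4_runs hm hω hv hD hU h12 h23 h34 hr12 hr23 hr34 ht3 ht6 ht7 hp1 hR0 hP1x hP1y hhor
  obtain ⟨-, hx_p₄, -, -⟩ := of_mem_stepsD_coord hbw (i := p₄) (by rw [hD]; simp)
  have hy_p₄ := (hrun6 p₄ (by omega) le_rfl).2
  have hy_r₃ := (hrun5 r₃ (by omega) le_rfl).2
  have hR4' := hR8 (r₄ + 1) le_rfl (by omega)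
  simp only [Nat.sub_self, Nat.cast_zero, add_zero] at hR4'
  have hrun7' := ddduuudu_plateau hm hω hv hD hU h12 h23 h34 hr12 hr23 hr34 ht3 ht6 ht7 hp1 hR0 hP1x hP1y hhor
  have hR7 := (hrun7' r₄ (by omega) le_rfl).1
  have hP4 := (hrun6 p₄ (by omega) le_rfl).1
  obtain rfl : e₆ = 1 := by
    rcases he6 with h | rfl
    · exact h
    exfalso
    rcases Nat.lt_or_ge (r₃ + r₄) (2 * p₄) with hlt | hge
    · obtain ⟨hjx, hjy⟩ := hrun6 (2 * p₄ - r₄ + 1) (by omega) (by omega)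
      have hc := hinj (hmem (2 * p₄ - r₄ + 1) (by omega)) (hmem (r₄ + 1) (by omega))
        (site_ext_hb (by rw [hR4'.1]; omega) (by rw [hjy, hR4'.2]))
      omega
    · obtain ⟨hjx, hjy⟩ := hrun7' (2 * p₄ - r₃) (by omega) (by omega)
      have hc := hinj (hmem (2 * p₄ - r₃) (by omega)) (hmem r₃ (by omega)) (site_ext_hb (by omega) (by rw [hjy, hy_r₃]))
      omega
  simpa only [one_mul] using hrun6

open Classical in
/-- Step 3 for `ddduuudu_slack_four_false`: at most ONE interior visit time is a near-renewal (namely the time `2`): a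
near-renewal on the last wall run or on the final wall run would be a wall-renewal time (`isWRen_of_profile`), and an
initial-run visit time `t ≥ 4` is followed by the return of the walk to the column `2`.  OURS (routine).
[cite: MadrasSlade1993, §4.2, Definition 4.2.1 (p. 90), remark before (4.2.21) (p. 94); EntingJensen2009, §7.4.2, Fig. 7.10] -/
theorem ddduuudu_card_nearRenewal_le {k m : ℕ} (hm : m = 6 * k + 4) (hω : ω ∈ ipwb m) (hv : visits m ω = k)
    {p₁ p₂ p₃ p₄ r₁ r₂ r₃ r₄ : ℕ} (hD : stepsD m ω = {p₁, p₂, p₃, p₄}) (hU : stepsU m ω = {r₁, r₂, r₃, r₄}) (h12 : p₁ < p₂)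
    (h23 : p₂ < p₃) (h34 : p₃ < p₄) (hr12 : r₁ < r₂) (hr23 : r₂ < r₃) (hr34 : r₃ < r₄) (ht3 : p₃ < r₁) (ht6 : r₃ < p₄) (ht7 : p₄ < r₄) (hp1 : 1 ≤ p₁)
    (hR0 : ∀ i, i ≤ p₁ → ω i 0 = i ∧ ω i 1 = 0) (hP1x : ω (p₁ + 1) 0 = p₁) (hP1y : ω (p₁ + 1) 1 = -1)
    (hhor : ∀ i, i < m → i ∉ stepsD m ω → i ∉ stepsU m ω →
      ω (i + 1) 1 = ω i 1 ∧ (ω (i + 1) 0 = ω i 0 + 1 ∨ ω (i + 1) 0 = ω i 0 - 1)) :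
    #(((wallTimes m ω).erase m).filter fun t => NearRenewal m ω t) ≤ 1 := by
  classical
  obtain ⟨hpw, hn1, hirr⟩ := mem_ipwb.1 hω
  obtain ⟨hw, hb⟩ := mem_pwb.1 hpw
  obtain ⟨ha, -⟩ := mem_wbr.1 hw
  obtain ⟨hh, -, -⟩ := mem_archs.1 ha
  obtain ⟨hs, hhp⟩ := mem_hpw.1 hh
  obtain ⟨h0, -, hbw, hinj⟩ := mem_saws_iff.1 hs
  have hX0 : ω 0 0 = 0 := by rw [h0]; rfl
  have hb' : ∀ i, 1 ≤ i → i ≤ m → 0 < ω i 0 ∧ ω i 0 ≤ ω m 0 := fun i h1 h2 => by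
    have := hb i h1 h2; rwa [hX0] at this
  have hmem : ∀ i, i ≤ m → i ∈ {i | i ≤ m} := fun i hi => hi
  obtain ⟨e₁, e₂, e₃, e₄, e₅, e₆, e₇, -, -, -, -, -, he6, he7, hrun1, hrun2, hrun3, hrun4, hrun5, hrun6, hrun7, hR8,
    hs_eq, hN', -, -, -, -, hparc_r₃, hparc_p₄, -, -, -, -, -, hpos_r₃, -, -, -, -, hgap6, hgap7, hn_r₄⟩ :=
    ddduuudu4_runs hm hω hv hD hU h12 h23 h34 hr12 hr23 hr34 ht3 ht6 ht7 hp1 hR0 hP1x hP1y hhor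
  obtain ⟨-, hx_p₄, -, -⟩ := of_mem_stepsD_coord hbw (i := p₄) (by rw [hD]; simp)
  have hy_p₄ := (hrun6 p₄ (by omega) le_rfl).2
  have hy_r₃ := (hrun5 r₃ (by omega) le_rfl).2
  have hR4' := hR8 (r₄ + 1) le_rfl (by omega)
  simp only [Nat.sub_self, Nat.cast_zero, add_zero] at hR4'
  have hrun7' := ddduuudu_plateau hm hω hv hD hU h12 h23 h34 hr12 hr23 hr34 ht3 ht6 ht7 hp1 hR0 hP1x hP1y hhor
  have hrun6' := ddduuudu_wallRun hm hω hv hD hU h12 h23 h34 hr12 hr23 hr34 ht3 ht6 ht7 hp1 hR0 hP1x hP1y hhor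
  have hR7 := (hrun7' r₄ (by omega) le_rfl).1
  have hP4 := (hrun6' p₄ (by omega) le_rfl).1
  have htodd_p₄ : p₄ % 2 = 1 := by
    have := parity_apply hs (show p₄ ≤ m by omega); rw [hy_p₄] at this; omega
  refine le_trans (Finset.card_le_card fun t ht => ?_) (Finset.card_singleton 2).le
  rw [Finset.mem_filter, Finset.mem_erase, wallTimes, Finset.mem_filter, Finset.mem_Icc] at ht
  obtain ⟨⟨htm, ⟨ht1, htm'⟩, ht2, hy⟩, hR, hhead, htail⟩ := ht
  rw [Finset.mem_singleton]
  have htm'' : t < m := lt_of_le_of_ne htm' htm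
  rcases Nat.lt_or_ge t (p₁ + 1) with h0 | h0
  · -- an initial-run visit `t ≥ 4` is not a near-renewal: the walk comes back to the column `2`
    by_contra hne
    have ht4 : 4 ≤ t := by omega
    obtain ⟨i, him, hiL, hix⟩ := exists_left_step_onto hω (show 1 ≤ 2 by norm_num) (show 2 < m by omega) (by norm_num)
      (hR0 2 (by omega)).2 (by rw [(hR0 3 (by omega)).1, (hR0 2 (by omega)).1]; norm_num)
    have hip : p₁ ≤ i := by
      by_contra hlt
      have h1 := (hR0 (i + 1) (by omega)).1
      have h2 := (hR0 i (by omega)).1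
      rw [h1, h2] at hiL
      push_cast at hiL
      omega
    have := htail (i + 1) (by omega) (by omega)
    rw [(hR0 t (by omega)).1, hix, (hR0 2 (by omega)).1] at this
    push_cast at this
    omega
  exfalso
  rcases Nat.lt_or_ge t (p₂ + 1) with h1 | h1
  · have := (hrun1 t h0 (by omega)).2; omega
  rcases Nat.lt_or_ge t (p₃ + 1) with h2 | h2
  · have := (hrun2 t h1 (by omega)).2; omega
  rcases Nat.lt_or_ge t (r₁ + 1) with h3 | h3
  · have := (hrun3 t h2 (by omega)).2; omega
  rcases Nat.lt_or_ge t (r₂ + 1) with h4 | h4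
  · have := (hrun4 t h3 (by omega)).2; omega
  rcases Nat.lt_or_ge t (r₃ + 1) with h5 | h5
  · have := (hrun5 t h4 (by omega)).2; omega
  rcases Nat.lt_or_ge t p₄ with h6 | h6
  · -- on the last wall run: everything later lies strictly to the right, so `t` is a wall-renewal time
    refine hirr t ht1 htm'' (isWRen_of_profile hb htm' ht2 hy (fun i hi1 hi2 => ?_) fun j hj1 hj2 => ?_)
    · rcases Nat.lt_or_ge i t with hit | hit
      · have := hhead i hit; omega
      · rw [show i = t by omega]
    · have hxt := (hrun6' t h5 (by omega)).1
      rcases Nat.lt_or_ge j (p₄ + 1) with hj | hj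
      · have := (hrun6' j (by omega) (by omega)).1; omega
      rcases Nat.lt_or_ge j (r₄ + 1) with hj' | hj'
      · have := (hrun7' j hj (by omega)).1; omega
      · have := (hR8 j hj' hj2).1; omega
  rcases Nat.lt_or_ge t (p₄ + 1) with h6' | h6'
  · -- `t = p₄` is the dive time: the step after it is not to the right
    rw [show t = p₄ by omega] at hR; omega
  rcases Nat.lt_or_ge t (r₄ + 1) with h7 | h7
  · have := (hrun7 t h6' (by omega)).2; omega
  · -- on the final wall run: a wall-renewal time
    refine hirr t ht1 htm'' (isWRen_of_profile hb htm' ht2 hy (fun i hi1 hi2 => ?_) fun j hj1 hj2 => ?_)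
    · rcases Nat.lt_or_ge i t with hit | hit
      · have := hhead i hit; omega
      · rw [show i = t by omega]
    · have := (hR8 t h7 htm').1; have := (hR8 j (by omega) hj2).1; omega

open Classical in
/-- **The order `D D D U U U D U` does not occur at slack four.** For an irreducible positive wall bridge of length `6k + 4`
(`k ≥ 2`) with `k` visits and four down steps, in the vertical profile of `profile_of_card_stepsD_eq_four`, the order
`p₁ < p₂ < p₃ < r₁ < r₂ < r₃ < p₄ < r₄` of its down times `pᵢ` and up times `rᵢ` is impossible: by
`ddduuudu_card_nearRenewal_le` and `slack_four_counts` the span is `2k + 2`, but the return column `X_{r₃} ≥ p₁ + 2` and the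
visit count give `X_{r₃} = p₁ + p₄ + 3 − r₄ ≤ p₁ + 1`.  NEW, a-idea-1 lineage.
[cite: MadrasSlade1993, §4.2, Definition 4.2.1 (p. 90), remark before (4.2.21) (p. 94); EntingJensen2009, §7.4.2, Fig. 7.10] -/
theorem ddduuudu_slack_four_false {k m : ℕ} (hk : 2 ≤ k) (hm : m = 6 * k + 4) (hω : ω ∈ ipwb m) (hv : visits m ω = k)
    (hcD : #(stepsD m ω) = 4) {p₁ p₂ p₃ p₄ r₁ r₂ r₃ r₄ : ℕ} (hD : stepsD m ω = {p₁, p₂, p₃, p₄})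
    (hU : stepsU m ω = {r₁, r₂, r₃, r₄}) (h12 : p₁ < p₂) (h23 : p₂ < p₃) (h34 : p₃ < p₄) (hr12 : r₁ < r₂)
    (hr23 : r₂ < r₃) (hr34 : r₃ < r₄) (ht3 : p₃ < r₁) (ht6 : r₃ < p₄) (ht7 : p₄ < r₄) (hp1 : 1 ≤ p₁)
    (hR0 : ∀ i, i ≤ p₁ → ω i 0 = i ∧ ω i 1 = 0) (hP1x : ω (p₁ + 1) 0 = p₁) (hP1y : ω (p₁ + 1) 1 = -1)
    (hhor : ∀ i, i < m → i ∉ stepsD m ω → i ∉ stepsU m ω →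
      ω (i + 1) 1 = ω i 1 ∧ (ω (i + 1) 0 = ω i 0 + 1 ∨ ω (i + 1) 0 = ω i 0 - 1)) : False := by
  classical
  obtain ⟨hpw, hn1, hirr⟩ := mem_ipwb.1 hω
  obtain ⟨hw, hb⟩ := mem_pwb.1 hpw
  obtain ⟨ha, -⟩ := mem_wbr.1 hw
  obtain ⟨hh, -, -⟩ := mem_archs.1 ha
  obtain ⟨hs, hhp⟩ := mem_hpw.1 hh
  obtain ⟨h0, -, hbw, hinj⟩ := mem_saws_iff.1 hs
  have hX0 : ω 0 0 = 0 := by rw [h0]; rfl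
  have hb' : ∀ i, 1 ≤ i → i ≤ m → 0 < ω i 0 ∧ ω i 0 ≤ ω m 0 := fun i h1 h2 => by
    have := hb i h1 h2; rwa [hX0] at this
  have hmem : ∀ i, i ≤ m → i ∈ {i | i ≤ m} := fun i hi => hi
  obtain ⟨e₁, e₂, e₃, e₄, e₅, e₆, e₇, -, -, -, -, -, he6, he7, hrun1, hrun2, hrun3, hrun4, hrun5, hrun6, hrun7, hR8,
    hs_eq, hN', -, -, -, -, hparc_r₃, hparc_p₄, -, -, -, -, -, hpos_r₃, -, -, -, -, hgap6, hgap7, hn_r₄⟩ :=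
    ddduuudu4_runs hm hω hv hD hU h12 h23 h34 hr12 hr23 hr34 ht3 ht6 ht7 hp1 hR0 hP1x hP1y hhor
  obtain ⟨-, hx_p₄, -, -⟩ := of_mem_stepsD_coord hbw (i := p₄) (by rw [hD]; simp)
  have hy_p₄ := (hrun6 p₄ (by omega) le_rfl).2
  have hy_r₃ := (hrun5 r₃ (by omega) le_rfl).2
  have hR4' := hR8 (r₄ + 1) le_rfl (by omega)
  simp only [Nat.sub_self, Nat.cast_zero, add_zero] at hR4'
  have hrun7' := ddduuudu_plateau hm hω hv hD hU h12 h23 h34 hr12 hr23 hr34 ht3 ht6 ht7 hp1 hR0 hP1x hP1y hhor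
  have hrun6' := ddduuudu_wallRun hm hω hv hD hU h12 h23 h34 hr12 hr23 hr34 ht3 ht6 ht7 hp1 hR0 hP1x hP1y hhor
  have hE1 := ddduuudu_card_nearRenewal_le hm hω hv hD hU h12 h23 h34 hr12 hr23 hr34 ht3 ht6 ht7 hp1 hR0 hP1x hP1y hhor
  have hR7 := (hrun7' r₄ (by omega) le_rfl).1
  have hP4 := (hrun6' p₄ (by omega) le_rfl).1
  -- the span is `2k + 2`
  obtain ⟨hX3, -, -, -, -, -, h6x, -, h4x⟩ := slack_four_counts hk hm hω hv
  have hX : ω m 0 = 2 * k + 2 := by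
    rcases hX3 with h | h | h
    · exact h
    · have := ((h4x h).1 hcD).1; omega
    · have := (h6x h).1; omega
  -- the return column `c₀ = X_{r₃}` is a fresh odd wall column: `c₀ ≥ p₁ + 2`
  obtain ⟨c, hc⟩ : ∃ c : ℕ, ω r₃ 0 = c := ⟨_, (Int.toNat_of_nonneg hpos_r₃.le).symm⟩
  obtain ⟨hx3, hy3⟩ := hrun6' (r₃ + 1) le_rfl (by omega)
  simp only [Nat.sub_self, Nat.cast_zero, add_zero] at hx3
  have hpodd : p₁ % 2 = 1 := by
    obtain ⟨-, -, -, hpar⟩ := of_mem_stepsD_coord hbw (i := p₁) (by rw [hD]; simp)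
    rw [hP1x, hP1y] at hpar; omega
  have hc2 : (p₁ : ℤ) + 2 ≤ ω r₃ 0 := by
    by_contra hlt
    have hcp : c ≤ p₁ := by omega
    have := hinj (hmem (r₃ + 1) (by omega)) (hmem c (by omega))
      (site_ext_hb (by rw [hx3, (hR0 c hcp).1, hc]) (by rw [hy3, (hR0 c hcp).2]))
    omega
  -- the count
  omega

end Literature.Probability.RandomPlanarGeometry.SAW.HexBW.Wall
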